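import Mathlib.MeasureTheory.Function.UniformIntegrable
import Literature.MathematicalPhysics.KineticTheory.InfiniteChainCurrentMoments
import Literature.Analysis.FunctionSpaces.WeakCompactnessL1
import HarnessLib

/-!
# Continuity in time of the current–current correlation terms

Topic `Literature/MathematicalPhysics/KineticTheory` (companion of `InfiniteChainCurrentMoments`).
For the infinite chain `P : OscillatorChain` (`U ≥ 0` measurable, `V` an even non-negative polynomial
of degree `≥ 2`), an infinite-volume dynamics `D : InfiniteChainDynamics P` and a state `μ` with
Buttà–Marchioro's superstability estimate (2.3) preserved by `D` (`D.PreservesMeasure μ`), every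
term `t ↦ ∫ j_y (j_x ∘ φ_t) dμ` of the space-summed current autocorrelation
`D.currentCorrelation μ t` is a CONTINUOUS function of time (`continuous_integral_bondCurrentZ_mul_flow`):

* orbits are solutions of the equations of motion, so `t ↦ j_x(φ_t σ)` is continuous for every
  `σ` in the carrier (`continuous_bondCurrentZ_flow`), i.e. for `μ`-a.e. `σ`;
* the integrands `j_y · (j_x ∘ φ_t)`, `t ∈ ℝ`, are EQUI-INTEGRABLE: their squares have integrals
  bounded uniformly in `t` by the fourth moments of the current (`|ab|² ≤ (a⁴ + b⁴)/2`, invariance of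
  `μ` under `φ_t`, `InfiniteChainCurrentMoments`), and a uniformly integrable superlinear function of
  the family gives equi-integrability (de la Vallée-Poussin,
  `Literature.Analysis.FunctionSpaces.unifIntegrable_of_lintegral_superlinear_le`);
* Vitali's convergence theorem (`MeasureTheory.tendsto_Lp_finite_of_tendsto_ae`) along every sequence
  of times, and sequential continuity.

This is the termwise input for the continuity at `t = 0` of the summed correlation functions (the
strong-continuity hypothesis of Doyon's Koopman group) and for the measurability in `t` of the
Green–Kubo integrands. Everything is proved; tagged `[folklore]`. No definitions, no named facts.
-/

noncomputable section

open MeasureTheory Filter Set Function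
open scoped Topology ENNReal

namespace Literature.MathematicalPhysics.KineticTheory.HeatConduction

namespace InfiniteChainDynamics

variable {P : OscillatorChain} (D : InfiniteChainDynamics P)

/-- **Orbits are continuous in time, coordinatewise**: for `σ` in the carrier, `t ↦ (φ_t σ)_i` is
continuous (it is differentiable: orbits solve the equations of motion). [folklore] -/
theorem continuous_flow_apply {σ : ChainConfig} (hσ : σ ∈ D.carrier) (i : ℤ) :
    Continuous fun t : ℝ => D.flow t σ i := by
  have hsol := D.isSolution σ hσ
  have h1 : Continuous fun t : ℝ => (D.flow t σ i).1 :=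
    continuous_iff_continuousAt.2 fun t => (hsol i t).1.continuousAt
  have h2 : Continuous fun t : ℝ => (D.flow t σ i).2 :=
    continuous_iff_continuousAt.2 fun t => (hsol i t).2.continuousAt
  exact h1.prodMk h2

/-- **The bond current along an orbit is continuous in time** (`V'` continuous). [folklore] -/
theorem continuous_bondCurrentZ_flow (hVc : Continuous (deriv P.V)) {σ : ChainConfig}
    (hσ : σ ∈ D.carrier) (x : ℤ) : Continuous fun t : ℝ => P.bondCurrentZ (D.flow t σ) x := by
  have hq : ∀ i : ℤ, Continuous fun t : ℝ => (D.flow t σ i).1 := fun i =>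
    continuous_fst.comp (D.continuous_flow_apply hσ i)
  have hp : ∀ i : ℤ, Continuous fun t : ℝ => (D.flow t σ i).2 := fun i =>
    continuous_snd.comp (D.continuous_flow_apply hσ i)
  unfold OscillatorChain.bondCurrentZ
  exact ((((hp x).add (hp (x + 1))).div_const 2).mul (hVc.comp ((hq (x + 1)).sub (hq x)))).neg

/-- **Uniform second moments of the correlation integrands**: under (2.3) there is `M` with
`j_y² (j_x ∘ φ)² ∈ L¹(μ)` and `∫ j_y² (j_x ∘ φ)² dμ ≤ M` for every `μ`-preserving `φ` and all bonds
(`2a²b² ≤ a⁴ + b⁴`, invariance, uniform fourth moments of the current). [folklore] -/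
theorem _root_.Literature.MathematicalPhysics.KineticTheory.HeatConduction.OscillatorChain.HasSuperstabilityEstimate.exists_integral_sq_mul_sq_comp_le
    {μ : Measure ChainConfig} (hss : P.HasSuperstabilityEstimate μ) {s₂ : ℕ} (h₂ : 1 ≤ s₂)
    (hU0 : ∀ r, 0 ≤ P.U r) (hUm : Measurable P.U) (hV : OscillatorChain.IsEvenPolyOfDegree P.V s₂) :
    ∃ M : ℝ, ∀ (φ : ChainConfig → ChainConfig), MeasurePreserving φ μ μ → ∀ x y : ℤ,
      Integrable (fun σ => (P.bondCurrentZ σ y * P.bondCurrentZ (φ σ) x) ^ 2) μ ∧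
      ∫ σ, (P.bondCurrentZ σ y * P.bondCurrentZ (φ σ) x) ^ 2 ∂μ ≤ M := by
  obtain ⟨M, hM⟩ := hss.exists_integral_abs_bondCurrentZ_pow_le h₂ hU0 hUm hV
  refine ⟨M 4, fun φ hφ x y => ?_⟩
  obtain ⟨hiy, hley⟩ := hM 4 y
  obtain ⟨hix, hlex⟩ := hM 4 x
  have e4 : ∀ (τ : ChainConfig) (z : ℤ), |P.bondCurrentZ τ z| ^ 4 = P.bondCurrentZ τ z ^ 4 :=
    fun τ z => Even.pow_abs (by decide) _
  have hixφ : Integrable (fun σ => |P.bondCurrentZ (φ σ) x| ^ 4) μ := hφ.integrable_comp_of_integrable hix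
  have heq : ∫ σ, |P.bondCurrentZ (φ σ) x| ^ 4 ∂μ = ∫ σ, |P.bondCurrentZ σ x| ^ 4 ∂μ := by
    have h := integral_map (μ := μ) hφ.measurable.aemeasurable (f := fun σ => |P.bondCurrentZ σ x| ^ 4)
      (by rw [hφ.map_eq]
          exact ((continuous_abs.measurable.comp (measurable_bondCurrentZ P x)).pow_const 4).aestronglyMeasurable)
    rw [hφ.map_eq] at h
    exact h.symm
  have hdom : Integrable (fun σ => (|P.bondCurrentZ σ y| ^ 4 + |P.bondCurrentZ (φ σ) x| ^ 4) / 2) μ :=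
    (hiy.add hixφ).div_const 2
  have hpt : ∀ σ, (P.bondCurrentZ σ y * P.bondCurrentZ (φ σ) x) ^ 2 ≤
      (|P.bondCurrentZ σ y| ^ 4 + |P.bondCurrentZ (φ σ) x| ^ 4) / 2 := by
    intro σ
    rw [e4, e4, mul_pow]
    have h := two_mul_le_add_sq (P.bondCurrentZ σ y ^ 2) (P.bondCurrentZ (φ σ) x ^ 2)
    nlinarith
  have hmeas : AEStronglyMeasurable (fun σ => (P.bondCurrentZ σ y * P.bondCurrentZ (φ σ) x) ^ 2) μ :=
    (((measurable_bondCurrentZ P y).mul ((measurable_bondCurrentZ P x).comp hφ.measurable)).pow_const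
      2).aestronglyMeasurable
  have hint : Integrable (fun σ => (P.bondCurrentZ σ y * P.bondCurrentZ (φ σ) x) ^ 2) μ := by
    refine hdom.mono' hmeas (Eventually.of_forall fun σ => ?_)
    rw [Real.norm_of_nonneg (sq_nonneg _)]
    exact hpt σ
  refine ⟨hint, ?_⟩
  calc ∫ σ, (P.bondCurrentZ σ y * P.bondCurrentZ (φ σ) x) ^ 2 ∂μ
      ≤ ∫ σ, (|P.bondCurrentZ σ y| ^ 4 + |P.bondCurrentZ (φ σ) x| ^ 4) / 2 ∂μ := integral_mono hint hdom hpt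
    _ = ((∫ σ, |P.bondCurrentZ σ y| ^ 4 ∂μ) + ∫ σ, |P.bondCurrentZ (φ σ) x| ^ 4 ∂μ) / 2 := by
        rw [integral_div, integral_add hiy hixφ]
    _ ≤ (M 4 + M 4) / 2 := by rw [heq]; gcongr
    _ = M 4 := by ring

/-- **Equi-integrability of the correlation integrands in time**: under (2.3) and
`D.PreservesMeasure μ`, the family `σ ↦ j_y(σ) j_x(φ_t σ)`, `t ∈ ℝ`, is uniformly integrable in
`L¹(μ)` (de la Vallée-Poussin with `γ(u) = u²` and the uniform second moments). [folklore] -/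
theorem unifIntegrable_bondCurrentZ_mul_flow {μ : Measure ChainConfig}
    (hss : P.HasSuperstabilityEstimate μ) {s₂ : ℕ} (h₂ : 1 ≤ s₂) (hU0 : ∀ r, 0 ≤ P.U r)
    (hUm : Measurable P.U) (hV : OscillatorChain.IsEvenPolyOfDegree P.V s₂) (hD : D.PreservesMeasure μ)
    (x y : ℤ) :
    UnifIntegrable (fun t : ℝ => fun σ => P.bondCurrentZ σ y * P.bondCurrentZ (D.flow t σ) x) 1 μ := by
  obtain ⟨M, hM⟩ := hss.exists_integral_sq_mul_sq_comp_le h₂ hU0 hUm hV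
  have hmeas : ∀ t : ℝ, AEStronglyMeasurable
      (fun σ => P.bondCurrentZ σ y * P.bondCurrentZ (D.flow t σ) x) μ := fun t =>
    ((measurable_bondCurrentZ P y).mul
      ((measurable_bondCurrentZ P x).comp (hD.2 t).measurable)).aestronglyMeasurable
  have hγ : Tendsto (fun u : ℝ => u ^ 2 / u) atTop atTop := by
    refine tendsto_id.congr' ?_
    filter_upwards [eventually_ne_atTop 0] with u hu
    simp only [id_eq]; field_simp
  refine Literature.Analysis.FunctionSpaces.unifIntegrable_of_lintegral_superlinear_le hmeas hγ
    (M := ENNReal.ofReal M) ENNReal.ofReal_ne_top fun t => ?_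
  obtain ⟨hint, hle⟩ := hM (D.flow t) (hD.2 t) x y
  have e : ∀ σ, ‖P.bondCurrentZ σ y * P.bondCurrentZ (D.flow t σ) x‖ ^ 2 =
      (P.bondCurrentZ σ y * P.bondCurrentZ (D.flow t σ) x) ^ 2 := fun σ => by
    rw [Real.norm_eq_abs, sq_abs]
  simp_rw [e]
  rw [← ofReal_integral_eq_lintegral_ofReal hint (Eventually.of_forall fun σ => sq_nonneg _)]
  exact ENNReal.ofReal_le_ofReal hle

/-- **Continuity in time of the correlation terms.** Under BM's superstability estimate (2.3),
`D.PreservesMeasure μ`, `U ≥ 0` measurable and `V` an even non-negative polynomial of degree `≥ 2`: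
for all bonds `x, y`, the function `t ↦ ∫ j_y (j_x ∘ φ_t) dμ` is continuous on `ℝ` (a.e. pointwise
continuity along orbits + equi-integrability + Vitali's convergence theorem). [folklore] -/
theorem continuous_integral_bondCurrentZ_mul_flow {μ : Measure ChainConfig}
    (hss : P.HasSuperstabilityEstimate μ) {s₂ : ℕ} (h₂ : 1 ≤ s₂) (hU0 : ∀ r, 0 ≤ P.U r)
    (hUm : Measurable P.U) (hV : OscillatorChain.IsEvenPolyOfDegree P.V s₂) (hD : D.PreservesMeasure μ)
    (x y : ℤ) :
    Continuous fun t : ℝ => ∫ σ, P.bondCurrentZ σ y * P.bondCurrentZ (D.flow t σ) x ∂μ := by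
  haveI : IsProbabilityMeasure μ := hss.1
  have hVc : Continuous (deriv P.V) := hV.contDiff_two.continuous_deriv (by norm_num)
  set f : ℝ → ChainConfig → ℝ := fun t σ => P.bondCurrentZ σ y * P.bondCurrentZ (D.flow t σ) x with hf
  have hmeas : ∀ t : ℝ, AEStronglyMeasurable (f t) μ := fun t =>
    ((measurable_bondCurrentZ P y).mul
      ((measurable_bondCurrentZ P x).comp (hD.2 t).measurable)).aestronglyMeasurable
  have hint : ∀ t : ℝ, Integrable (f t) μ := fun t =>
    hss.integrable_bondCurrentZ_mul_comp h₂ hU0 hUm hV (hD.2 t) x y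
  have hui := D.unifIntegrable_bondCurrentZ_mul_flow hss h₂ hU0 hUm hV hD x y
  -- pointwise continuity along a.e. orbit
  have hpt : ∀ᵐ σ ∂μ, Continuous fun t : ℝ => f t σ := by
    filter_upwards [hD.1] with σ hσ
    exact continuous_const.mul (D.continuous_bondCurrentZ_flow hVc hσ x)
  -- sequential continuity via Vitali
  refine continuous_iff_seqContinuous.2 fun u t hu => ?_
  have hui' : UnifIntegrable (fun n : ℕ => f (u n)) 1 μ := fun ε hε => by
    obtain ⟨δ, hδ, h⟩ := hui hε
    exact ⟨δ, hδ, fun n s hs hμs => h (u n) s hs hμs⟩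
  have hae : ∀ᵐ σ ∂μ, Tendsto (fun n : ℕ => f (u n) σ) atTop (𝓝 (f t σ)) := by
    filter_upwards [hpt] with σ hσ
    exact (hσ.tendsto t).comp hu
  have hL1 : Tendsto (fun n : ℕ => eLpNorm (f (u n) - f t) 1 μ) atTop (𝓝 0) :=
    tendsto_Lp_finite_of_tendsto_ae le_rfl ENNReal.one_ne_top (fun n => hmeas (u n))
      (memLp_one_iff_integrable.2 (hint t)) hui' hae
  have hL1' : Tendsto (fun n : ℕ => ∫⁻ σ, ‖f (u n) σ - f t σ‖ₑ ∂μ) atTop (𝓝 0) := by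
    refine hL1.congr fun n => ?_
    rw [eLpNorm_one_eq_lintegral_enorm]
    rfl
  exact tendsto_integral_of_L1 (f t) (hint t).aestronglyMeasurable
    (Eventually.of_forall fun n => hint (u n)) hL1'

/-- **Continuity in time of the correlation terms for the pinned anharmonic chain**
(`ω₂, lam ≥ 0`, `β > 0`). [folklore] -/
theorem continuous_integral_bondCurrentZ_mul_flow_pinnedChain {ω₂ lam β : ℝ} (γ : ℝ) (hω : 0 ≤ ω₂)
    (hl : 0 ≤ lam) (hβ : 0 < β) {μ : Measure ChainConfig}
    (hss : (pinnedChain ω₂ lam β γ).HasSuperstabilityEstimate μ)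
    (D : InfiniteChainDynamics (pinnedChain ω₂ lam β γ)) (hD : D.PreservesMeasure μ) (x y : ℤ) :
    Continuous fun t : ℝ => ∫ σ, (pinnedChain ω₂ lam β γ).bondCurrentZ σ y *
      (pinnedChain ω₂ lam β γ).bondCurrentZ (D.flow t σ) x ∂μ :=
  D.continuous_integral_bondCurrentZ_mul_flow hss one_le_two
    (OscillatorChain.pinnedChain_U_nonneg β γ hω hl) (OscillatorChain.measurable_pinnedChain_U ω₂ lam β γ)
    (OscillatorChain.pinnedChain_isEvenPolyOfDegree_V ω₂ lam γ hβ) hD x y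

end InfiniteChainDynamics

end Literature.MathematicalPhysics.KineticTheory.HeatConduction

end
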